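import Literature.IUT.HodgeTheaters.FrobenioidBridgeModelsProofs
import Literature.IUT.HodgeTheaters.PiAvatarKitCoreThetaS5LocalWitness
import HarnessLib

/-!
# Proofs for [IUTchI] Example 5.4 (iv) (pp. 148–149): the poly-morphisms `‡ℱ → †ℱ^⊚` — torsor of choices,
# pre- and post-composition, fixedness under `Aut(‡ℱ)` and `Aut_ε(†ℱ^⊚)`, the induced `‡𝒟 → †𝒟^⊚`, capsules;
# schema-level over EVERY stub `S : S5Local 𝔡`, and non-vacuity at the §5-R4 stub of record over the
# parametric bad-pair datum (cell abc-iut, seat abc-iut-L5-t9 gen 8, row EX54IV; PROOF-ONLY)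

S. Mochizuki, *Inter-universal Teichmüller theory I*, kurims manuscript (May 2020), Example 5.4 (iv)
pp. 148–149 ([IUTchI] Ex 5.4 (iv) p.148) [claim: Mochizuki2012, status: disputed] (D-0012 claim key, series
status DISPUTED — proofs about the cell's OWN typing `FrobenioidBridgeModels.lean` (abc-iut-L5-t3, p407134);
nothing of the series is asserted and no side is taken on [IUTchIII] Cor. 3.12).

## What is proved (every item over an ARBITRARY stub `S : S5Local 𝔡`, hence at every instantiation)

In abc-iut-L5-t3's typing a poly-morphism `‡ℱ → †ℱ^⊚` IS the choice of `δ ∈ LabCusp(†𝒟^⊚)`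
(`FPolyHomNF S X Y := 𝔡.LabCuspG (S.baseG Y)`), its full poly-isomorphism `‡ℱ ⥲ †ℱ^⊚|_δ` is `FPolyHomNF.polyIso`,
and the induced `‡𝒟 → †𝒟^⊚` is `FPolyHomNF.under δ` (the `φ^NF`-type morphisms pulling `δ` back to the class
labeled `1`).  Print, p. 148 l. −9 – p. 149 l. 2 and p. 149 last paragraph, sentence by sentence:

* «a poly-morphism `‡ℱ → †ℱ^⊚` [is] a full poly-isomorphism `‡ℱ ⥲ †ℱ^⊚|_δ` for some `δ ∈ LabCusp(†𝒟^⊚)`»: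
  `FPolyHomNF.nonempty`, `FPolyHomNF.card_eq` (exactly `l^⋇` of them), `FPolyHomNF.nonempty_equiv_flStar`
  (an `F_l^⋇`-torsor of choices), `FPolyHomNF.polyIso_eq_full`, `FPolyHomNF.isPolyIso_polyIso`,
  `FPolyHomNF.polyIso_nonempty`; «`†ℱ^⊚|_δ` … well-defined up to isomorphism»: `restrictAt_nonempty_iso`.
* «it makes sense to pre-compose such poly-morphisms with isomorphisms of `ℱ`-prime-strips and to post-compose
  such poly-morphisms with isomorphisms between isomorphs of `†ℱ^⊚`»: in the `δ`-rendering pre-composition with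
  `a : ‡ℱ′ ⥲ ‡ℱ` keeps `δ` and post-composition with `b : †ℱ^⊚ ⥲ †ℱ′^⊚` transports it to `δ·b :=
  labIsoG (baseGIso b) δ`; the induced `𝒟`-poly-morphisms follow suit: `FPolyHomNF.under_pre`
  (`under_{‡ℱ′} δ = (under_{‡ℱ} δ) ∘ a`), `FPolyHomNF.under_labIsoG_baseGIso` (`under (δ·b) = b ∘ under δ`),
  with functoriality `labIsoG_baseGIso_refl` / `labIsoG_baseGIso_trans`.
* «any poly-morphism `‡ℱ → †ℱ^⊚` is fixed by pre-composition with automorphisms of `‡ℱ`»: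
  `FPolyHomNF.under_pre_aut` (any automorphism of the base constituent), `FPolyHomNF.under_pre_fAut` (any
  automorphism of the `ℱ`-prime-strip), `polyIso_full_comp_aut` / `aut_comp_polyIso_full` (the full
  poly-isomorphism absorbs automorphisms on either side);
* «as well as by post-composition with automorphisms `∈ Aut_ε(†ℱ^⊚)`»: `FPolyHomNF.labIsoG_baseGIso_eq_self_iff`
  — post-composition with `b` fixes `δ` IF AND ONLY IF the base automorphism of `b` lies in `Aut_ε(†𝒟^⊚)`
  (label `1`; abc-iut-L5-t3's `AutEps`, [IUTchI] Ex 4.3 (i)) — and `FPolyHomNF.labIsoG_baseGIso_of_mem_autEps`,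
  `FPolyHomNF.under_post_of_mem_autEps`;
* «such a poly-morphism `‡ℱ → †ℱ^⊚` may be thought of as "lying over" an induced poly-morphism `‡𝒟 → †𝒟^⊚`»:
  `FPolyHomNF.under_nonempty` (at every `v` the induced poly-morphism is inhabited), `FPolyHomNF.under_subset_setOf_exists_eq_phiNF`
  (its members are abstractly equivalent to `φ^NF_{•,v}`, Def 4.1 (vi)), `FPolyHomNF.eq_of_mem_under` /
  `FPolyHomNF.under_injective` (the induced `𝒟`-poly-morphism at any single `v` DETERMINES the poly-morphism);
* capsules (p. 149 last paragraph, «a collection of poly-morphisms `{ᵉℱ → †ℱ^⊚}_{e∈E}`» lying over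
  `{ᵉ𝒟}_{e∈E} → †𝒟^⊚`): `FCapsule.PolyHomNF.nonempty`, `FCapsule.PolyHomNF.card_eq` (`(l^⋇)^{|E|}`),
  `FCapsule.PolyHomNF.under_nonempty`.
* NON-VACUITY at ONE explicit datum built from abc-iut-L5-t2's REAL `InitialThetaData`: at the §5-R4 stub of record
  `D.s5LocalThetaOfBadPairs CG hS M hA hI B ΛBad ES` (abc-iut-w4-d054, `PiAvatarKitCoreThetaS5LocalWitness`, p497623)
  the binders `X, Y, δ, b ∈ Aut_ε` are jointly inhabited and all of the above fire:
  `InitialThetaData.exists_fPolyHomNF_s5LocalThetaOfBadPairs`, `InitialThetaData.card_fPolyHomNF_s5LocalThetaOfBadPairs`.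

## Binder census (abc-iut-L5-lead RULINGS #110 (4))

Displayed binders of §§1–5: `𝔡 : BaseThetaDatum`, `S : S5Local 𝔡` and DATA (`X`, `Y`, `δ`, `a`, `b`, `v`) — schema
level, NO law hypothesis, FACT 0, GAP 0.  §6: the kit binders {`CG`, `hS`, `M`, `hA`, `hI`, `B`, `ΛBad`, `ES`} of the
datum of record, nothing else.  HONEST LABELS: the NV datum is abc-iut-L5-t5's KIT-RULE stub `S5Local.ofKitCore`
«`ℱ_v`-data := isomorphs of `𝒟_v`, identity base; NF half = Θ-NF kit with parametric bad-pair DATA `B`» (labels of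
p497623 / p442128 travel) — a consistency device for the binder set, not print's Frobenioid-theoretic `ℱ`-data
«[stand-in, labelled]».  NOT COVERED (residual printed clause of Ex 5.4 (iv), p. 149 ll. 3–24): «such a poly-morphism
is compatible with the local and global `∞κ`-coric structures … restriction of associated Kummer classes determines
… poly-morphisms of pseudo-monoids `{π₁^{rat}(†𝒟^⊛) ↷ †𝕄^⊛_{∞κ} → ‡𝕄_{∞κv} ⊆ ‡𝕄_{∞κ×v}}_{v∈𝕍}` … equivariant …» —
UNTYPED over `S5Local` (the stub carries no Kummer / pseudo-monoid data; audit abc-iut-w4-d062 2026-08-25T23:29:47Z);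
its vocabulary lives over abc-iut-L5-t4's `PMBaseKit.CoricKit` (Def 5.2 (vi)(viii)) and abc-iut-L5-t1's
`GlobalFrobenioidsInfKappa` (Ex 5.1 (v)), and its producer is the merge object (m5) [AbsTopIII] Thm 1.9
(abc-iut-L5-lead «L5 HUB (27)» 2026-08-27T03:05:03Z) — after-merge, not claimed here.

PROOF-ONLY: no `def`, no `instance`, no notation, no `Prop` fact, no `sorry`; axioms ⊆ {propext, Classical.choice,
Quot.sound}.  typed ≠ inhabited ≠ proved; nothing here asserts that abc is proved or refuted.
-/

namespace Literature.IUT.HodgeTheaters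

open CategoryTheory

universe u

namespace BaseThetaDatum

variable {𝔡 : BaseThetaDatum.{u}}

/-! ### §0. Two torsor facts about global label classes -/

/-- A translation of the `F_l^⋇`-torsor `LabCusp(†𝒟^⊚)` fixing one class is trivial.
([IUTchI] Def 4.1 (v) p.97) [claim: Mochizuki2012, status: disputed] -/
theorem smul_labCuspG_eq_self_iff {Y : 𝔡.AmbG} (j : FlStar 𝔡.l) (c : 𝔡.LabCuspG Y) : j • c = c ↔ j = 1 :=
  ⟨fun h => ((𝔡.isTorsor_labCuspG Y).existsUnique_smul_eq c c).unique h (one_smul _ c), fun h => by rw [h, one_smul]⟩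

/-- An automorphism `b` of an isomorph `†𝒟^⊚` fixes a label class of cusps iff it fixes all of them iff its label is
`1`, i.e. iff `b ∈ Aut_ε(†𝒟^⊚)` ([IUTchI] Ex 4.3 (i): «the subgroup of elements which fix the cusp `ε`»).
([IUTchI] Ex 4.3 (i) p.98) [claim: Mochizuki2012, status: disputed] -/
theorem labIsoG_eq_self_iff_autLabel_eq_one {Y : 𝔡.AmbG} (b : Y ≅ Y) (c : 𝔡.LabCuspG Y) :
    𝔡.labIsoG b c = c ↔ autLabel b = 1 := by
  rw [← smul_labCuspG_eq_self_iff (autLabel b) c, ← labIsoG_symm_eq_autLabel_smul b c, Equiv.symm_apply_eq]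
  exact eq_comm

namespace S5Local

variable {S : S5Local 𝔡}

/-! ### §1. «a poly-morphism `‡ℱ → †ℱ^⊚` [is] a full poly-isomorphism `‡ℱ ⥲ †ℱ^⊚|_δ` for some `δ`» (p. 148) -/

/-- Poly-morphisms `‡ℱ → †ℱ^⊚` EXIST: there is a `δ ∈ LabCusp(†𝒟^⊚)` (transport `[ε]` along any `𝒟^⊚ ⥲ †𝒟^⊚`).
([IUTchI] Ex 5.4 (iv) p.148) [claim: Mochizuki2012, status: disputed] -/
theorem FPolyHomNF.nonempty (X : S.FPrimeStrip) (Y : S.FAmbG) : Nonempty (FPolyHomNF S X Y) :=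
  let ⟨a⟩ := 𝔡.nonempty_isoG 𝔡.DG (S.baseG Y); ⟨𝔡.labIsoG a 𝔡.εLab⟩

/-- The poly-morphisms `‡ℱ → †ℱ^⊚` form an `F_l^⋇`-torsor: once one is chosen, the others are its `F_l^⋇`-translates,
bijectively. ([IUTchI] Ex 5.4 (iv) p.148) [claim: Mochizuki2012, status: disputed] -/
theorem FPolyHomNF.nonempty_equiv_flStar (X : S.FPrimeStrip) (Y : S.FAmbG) :
    Nonempty (FPolyHomNF S X Y ≃ FlStar 𝔡.l) :=
  let ⟨δ⟩ := FPolyHomNF.nonempty X Y; ⟨((𝔡.isTorsor_labCuspG (S.baseG Y)).orbitEquiv δ).symm⟩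

/-- There are exactly `l^⋇ = (l-1)/2` poly-morphisms `‡ℱ → †ℱ^⊚`, one for each `δ ∈ LabCusp(†𝒟^⊚)`.
([IUTchI] Ex 5.4 (iv) p.148) [claim: Mochizuki2012, status: disputed] -/
theorem FPolyHomNF.card_eq (X : S.FPrimeStrip) (Y : S.FAmbG) : Nat.card (FPolyHomNF S X Y) = lStar 𝔡.l := by
  obtain ⟨δ⟩ := FPolyHomNF.nonempty X Y
  unfold FPolyHomNF
  rw [← Nat.card_congr ((𝔡.isTorsor_labCuspG (S.baseG Y)).orbitEquiv δ), card_flStar 𝔡.l 𝔡.l_ne_two]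

/-- The full poly-isomorphism `‡ℱ ⥲ †ℱ^⊚|_δ` carried by a poly-morphism is the FULL one (all isomorphisms).
([IUTchI] Ex 5.4 (iv) p.148) [claim: Mochizuki2012, status: disputed] -/
theorem FPolyHomNF.polyIso_eq_full {X : S.FPrimeStrip} {Y : S.FAmbG} (δ : FPolyHomNF S X Y) :
    δ.polyIso = PolyIso.full X (S.restrictAt Y δ) :=
  rfl

/-- … its underlying poly-morphism is a poly-isomorphism (§0 p. 33) …
([IUTchI] Ex 5.4 (iv) p.148) [claim: Mochizuki2012, status: disputed] -/
theorem FPolyHomNF.isPolyIso_polyIso {X : S.FPrimeStrip} {Y : S.FAmbG} (δ : FPolyHomNF S X Y) :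
    δ.polyIso.toPolyHom.IsPolyIso :=
  PolyIso.isPolyIso_toPolyHom _

/-- … and it is inhabited: isomorphisms `‡ℱ ⥲ †ℱ^⊚|_δ` exist (both are `ℱ`-prime-strips over the stub).
([IUTchI] Ex 5.4 (iv) p.148) [claim: Mochizuki2012, status: disputed] -/
theorem FPolyHomNF.polyIso_nonempty {X : S.FPrimeStrip} {Y : S.FAmbG} (δ : FPolyHomNF S X Y) :
    (δ.polyIso : Set (X ≅ S.restrictAt Y δ)).Nonempty :=
  let ⟨e⟩ := FPrimeStrip.nonempty_iso X (S.restrictAt Y δ); ⟨e, trivial⟩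

variable (S) in
/-- «`†ℱ^⊚|_δ` — which is well-defined up to isomorphism»: any two restrictions (at any classes, of any isomorphs) are
isomorphic `ℱ`-prime-strips over the stub. ([IUTchI] Ex 5.4 (iv) p.148) [claim: Mochizuki2012, status: disputed] -/
theorem restrictAt_nonempty_iso (Y Y' : S.FAmbG) (δ : 𝔡.LabCuspG (S.baseG Y)) (δ' : 𝔡.LabCuspG (S.baseG Y')) :
    Nonempty (S.restrictAt Y δ ≅ S.restrictAt Y' δ') :=
  FPrimeStrip.nonempty_iso _ _

/-! ### §2. «it makes sense to pre-compose … with isomorphisms of `ℱ`-prime-strips and to post-compose … with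
isomorphisms between isomorphs of `†ℱ^⊚`» (p. 148): the induced `𝒟`-poly-morphisms follow suit -/

/-- Membership in the induced poly-morphism `‡𝒟_v → †𝒟^⊚`, unfolded. ([IUTchI] Ex 5.4 (iv) p.148)
[claim: Mochizuki2012, status: disputed] -/
theorem FPolyHomNF.mem_under_iff {X : S.FPrimeStrip} {Y : S.FAmbG} (δ : FPolyHomNF S X Y) (v : 𝔡.V)
    (f : 𝔡.HomNF v (X.base v) (S.baseG Y)) : f ∈ FPolyHomNF.under δ v ↔ 𝔡.labPull f δ = 𝔡.η v (X.base v) :=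
  Iff.rfl

/-- PRE-COMPOSITION: for an isomorphism of base constituents `a : ‡𝒟′_v ⥲ ‡𝒟_v`, a `φ^NF`-type morphism `f` pulls `δ`
back to the canonical class of `‡𝒟_v` iff `f ∘ a` pulls it back to the canonical class of `‡𝒟′_v`.
([IUTchI] Ex 5.4 (iv) p.148) [claim: Mochizuki2012, status: disputed] -/
theorem labPull_preNF_eq_η_iff {v : 𝔡.V} {X X' : 𝔡.Amb v} {Y : 𝔡.AmbG} (a : X' ≅ X) (f : 𝔡.HomNF v X Y)
    (δ : 𝔡.LabCuspG Y) : 𝔡.labPull (𝔡.preNF a f) δ = 𝔡.η v X' ↔ 𝔡.labPull f δ = 𝔡.η v X := by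
  rw [𝔡.labPull_preNF, Equiv.symm_apply_eq, 𝔡.labIso_η]

/-- POST-COMPOSITION: for `b : †𝒟^⊚ ⥲ †𝒟′^⊚`, `b ∘ f` pulls the transported class `b(δ)` back to the canonical class iff
`f` pulls `δ` back to it. ([IUTchI] Ex 5.4 (iv) p.148) [claim: Mochizuki2012, status: disputed] -/
theorem labPull_postNF_labIsoG_eq_iff {v : 𝔡.V} {X : 𝔡.Amb v} {Y Y' : 𝔡.AmbG} (f : 𝔡.HomNF v X Y) (b : Y ≅ Y')
    (δ : 𝔡.LabCuspG Y) : 𝔡.labPull (𝔡.postNF f b) (𝔡.labIsoG b δ) = 𝔡.η v X ↔ 𝔡.labPull f δ = 𝔡.η v X := by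
  rw [𝔡.labPull_postNF, Equiv.symm_apply_apply]

/-- Every `φ^NF`-type morphism out of `‡𝒟′_v` is the pre-composite with `a : ‡𝒟′_v ⥲ ‡𝒟_v` of one out of `‡𝒟_v`.
([IUTchI] Def 4.1 (v) p.97) [claim: Mochizuki2012, status: disputed] -/
theorem preNF_preNF_symm {v : 𝔡.V} {X X' : 𝔡.Amb v} {Y : 𝔡.AmbG} (a : X' ≅ X) (g : 𝔡.HomNF v X' Y) :
    𝔡.preNF a (𝔡.preNF a.symm g) = g := by
  rw [← 𝔡.preNF_trans, Iso.self_symm_id, 𝔡.preNF_refl]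

/-- Every `φ^NF`-type morphism into `†𝒟′^⊚` is the post-composite with `b : †𝒟^⊚ ⥲ †𝒟′^⊚` of one into `†𝒟^⊚`.
([IUTchI] Def 4.1 (v) p.97) [claim: Mochizuki2012, status: disputed] -/
theorem postNF_symm_postNF {v : 𝔡.V} {X : 𝔡.Amb v} {Y Y' : 𝔡.AmbG} (g : 𝔡.HomNF v X Y') (b : Y ≅ Y') :
    𝔡.postNF (𝔡.postNF g b.symm) b = g := by
  rw [← 𝔡.postNF_trans, Iso.symm_self_id, 𝔡.postNF_refl]

/-- **Pre-composition with an isomorphism of `ℱ`-prime-strips** `a : ‡ℱ′ ⥲ ‡ℱ` (p. 148): the poly-morphism `‡ℱ′ → †ℱ^⊚`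
obtained from `δ : ‡ℱ → †ℱ^⊚` is the SAME choice `δ`, and its induced `‡𝒟′_v → †𝒟^⊚` is the pre-composite of the
induced `‡𝒟_v → †𝒟^⊚` with the base isomorphism `‡𝒟′_v ⥲ ‡𝒟_v` of `a` (Def 4.1 (v) «pre-composite»).
([IUTchI] Ex 5.4 (iv) p.148) [claim: Mochizuki2012, status: disputed] -/
theorem FPolyHomNF.under_pre {X X' : S.FPrimeStrip} {Y : S.FAmbG} (δ : FPolyHomNF S X Y) (a : X' ≅ X) (v : 𝔡.V) :
    FPolyHomNF.under (S := S) (X := X') (Y := Y) δ v =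
      (FPolyHomNF.under (X := X) δ v).pre ((S.base v).mapIso (Pi.isoApp a v)) := by
  ext g
  constructor
  · intro hg
    exact ⟨𝔡.preNF ((S.base v).mapIso (Pi.isoApp a v)).symm g,
      (labPull_preNF_eq_η_iff ((S.base v).mapIso (Pi.isoApp a v)).symm g δ).2 hg, (preNF_preNF_symm _ g).symm⟩
  · rintro ⟨f, hf, rfl⟩
    exact (labPull_preNF_eq_η_iff _ f δ).2 hf

/-- **Post-composition with an isomorphism `b : †ℱ^⊚ ⥲ †ℱ′^⊚` between isomorphs of `ℱ^⊚`** (p. 148): the poly-morphism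
`‡ℱ → †ℱ′^⊚` obtained from `δ` is the transported class `b(δ) := labIsoG (baseGIso b) δ`, and its induced
`‡𝒟_v → †𝒟′^⊚` is the post-composite of the induced `‡𝒟_v → †𝒟^⊚` with the base isomorphism of `b`
(Def 4.1 (v) «post-composite … with an isomorphism `†𝒟^⊚ ⥲ ‡𝒟^⊚`»).
([IUTchI] Ex 5.4 (iv) p.148) [claim: Mochizuki2012, status: disputed] -/
theorem FPolyHomNF.under_labIsoG_baseGIso {X : S.FPrimeStrip} {Y Y' : S.FAmbG} (δ : FPolyHomNF S X Y) (b : Y ≅ Y')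
    (v : 𝔡.V) :
    FPolyHomNF.under (S := S) (X := X) (Y := Y') (𝔡.labIsoG (S.baseGIso b) δ) v =
      (FPolyHomNF.under δ v).post {S.baseGIso b} := by
  ext g
  constructor
  · intro hg
    have h := labPull_postNF_labIsoG_eq_iff (𝔡.postNF g (S.baseGIso b).symm) (S.baseGIso b) δ
    rw [postNF_symm_postNF] at h
    exact ⟨𝔡.postNF g (S.baseGIso b).symm, h.1 hg, S.baseGIso b, rfl, (postNF_symm_postNF g _).symm⟩
  · rintro ⟨f, hf, b', hb', rfl⟩
    rw [Set.mem_singleton_iff] at hb'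
    subst hb'
    exact (labPull_postNF_labIsoG_eq_iff f _ δ).2 hf

/-- Post-composition is functorial: the identity of `†ℱ^⊚` keeps `δ`. ([IUTchI] Ex 5.4 (iv) p.148)
[claim: Mochizuki2012, status: disputed] -/
theorem labIsoG_baseGIso_refl {X : S.FPrimeStrip} (Y : S.FAmbG) (δ : FPolyHomNF S X Y) :
    𝔡.labIsoG (S.baseGIso (Iso.refl Y)) δ = δ := by
  rw [S.baseGIso_refl, 𝔡.labIsoG_refl, Equiv.refl_apply]

/-- Post-composition is functorial: composites of isomorphisms `†ℱ^⊚ ⥲ †ℱ′^⊚ ⥲ †ℱ″^⊚` act by the composite transport.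
([IUTchI] Ex 5.4 (iv) p.148) [claim: Mochizuki2012, status: disputed] -/
theorem labIsoG_baseGIso_trans {X : S.FPrimeStrip} {Y Y' Y'' : S.FAmbG} (b : Y ≅ Y') (b' : Y' ≅ Y'')
    (δ : FPolyHomNF S X Y) :
    𝔡.labIsoG (S.baseGIso (b ≪≫ b')) δ = 𝔡.labIsoG (S.baseGIso b') (𝔡.labIsoG (S.baseGIso b) δ) := by
  rw [S.baseGIso_trans, 𝔡.labIsoG_trans, Equiv.trans_apply]

/-! ### §3. «any poly-morphism `‡ℱ → †ℱ^⊚` is fixed by pre-composition with automorphisms of `‡ℱ`, as well as by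
post-composition with automorphisms `∈ Aut_ε(†ℱ^⊚)`» (p. 149 ll. 1–2) -/

/-- FIXED UNDER `Aut(‡𝒟_v)`: pre-composing the induced poly-morphism `‡𝒟_v → †𝒟^⊚` with ANY automorphism of the base
constituent `‡𝒟_v` returns the same poly-morphism (automorphisms fix the canonical class `‡η_v`, Def 4.1 (ii)).
([IUTchI] Ex 5.4 (iv) p.149) [claim: Mochizuki2012, status: disputed] -/
theorem FPolyHomNF.under_pre_aut {X : S.FPrimeStrip} {Y : S.FAmbG} (δ : FPolyHomNF S X Y) (v : 𝔡.V)
    (a : X.base v ≅ X.base v) : (FPolyHomNF.under δ v).pre a = FPolyHomNF.under δ v := by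
  ext g
  constructor
  · rintro ⟨f, hf, rfl⟩
    exact (labPull_preNF_eq_η_iff a f δ).2 hf
  · intro hg
    refine ⟨𝔡.preNF a.symm g, ?_, (preNF_preNF_symm a g).symm⟩
    exact (labPull_preNF_eq_η_iff a.symm g δ).2 hg

/-- **FIXED BY PRE-COMPOSITION WITH AUTOMORPHISMS OF `‡ℱ`** (p. 149 l. 1): for an automorphism `a` of the `ℱ`-prime-strip
`‡ℱ`, the pre-composite poly-morphism is the same `δ` (by §2) AND its induced `‡𝒟 → †𝒟^⊚` is unchanged.
([IUTchI] Ex 5.4 (iv) p.149) [claim: Mochizuki2012, status: disputed] -/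
theorem FPolyHomNF.under_pre_fAut {X : S.FPrimeStrip} {Y : S.FAmbG} (δ : FPolyHomNF S X Y) (a : X ≅ X) (v : 𝔡.V) :
    (FPolyHomNF.under δ v).pre ((S.base v).mapIso (Pi.isoApp a v)) = FPolyHomNF.under δ v :=
  FPolyHomNF.under_pre_aut δ v _

/-- The FULL poly-isomorphism `‡ℱ ⥲ †ℱ^⊚|_δ` absorbs automorphisms of `‡ℱ` on the left: `full ∘ {a} = full`
(§0: «the full poly-isomorphism … the collection of all isomorphisms»). ([IUTchI] Ex 5.4 (iv) p.149)
[claim: Mochizuki2012, status: disputed] -/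
theorem aut_comp_polyIso_full {C : Type*} [Category C] {A B : C} (a : A ≅ A) :
    PolyIso.comp ({a} : PolyIso A A) (PolyIso.full A B) = PolyIso.full A B := by
  ext e
  simp only [PolyIso.comp, PolyIso.full, Set.image2_singleton_left, Set.image_univ, Set.mem_range,
    Set.mem_univ, iff_true]
  exact ⟨a.symm ≪≫ e, by rw [← Iso.trans_assoc, Iso.self_symm_id, Iso.refl_trans]⟩

/-- … and automorphisms of the target on the right: `{c} ∘ full = full`. ([IUTchI] Ex 5.4 (iv) p.149)
[claim: Mochizuki2012, status: disputed] -/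
theorem polyIso_full_comp_aut {C : Type*} [Category C] {A B : C} (c : B ≅ B) :
    PolyIso.comp (PolyIso.full A B) ({c} : PolyIso B B) = PolyIso.full A B := by
  ext e
  simp only [PolyIso.comp, PolyIso.full, Set.image2_singleton_right, Set.image_univ, Set.mem_range,
    Set.mem_univ, iff_true]
  exact ⟨e ≪≫ c.symm, by rw [Iso.trans_assoc, Iso.symm_self_id, Iso.trans_refl]⟩

/-- In particular the full poly-isomorphism `‡ℱ ⥲ †ℱ^⊚|_δ` of a poly-morphism `‡ℱ → †ℱ^⊚` is fixed by pre-composition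
with any automorphism of `‡ℱ`. ([IUTchI] Ex 5.4 (iv) p.149) [claim: Mochizuki2012, status: disputed] -/
theorem FPolyHomNF.aut_comp_polyIso {X : S.FPrimeStrip} {Y : S.FAmbG} (δ : FPolyHomNF S X Y) (a : X ≅ X) :
    PolyIso.comp ({a} : PolyIso X X) δ.polyIso = δ.polyIso :=
  aut_comp_polyIso_full a

/-- **FIXED BY POST-COMPOSITION WITH `Aut_ε(†ℱ^⊚)` — AND ONLY BY IT** (p. 149 l. 2): post-composition with an
automorphism `b` of `†ℱ^⊚` fixes the poly-morphism `δ : ‡ℱ → †ℱ^⊚` IFF the base automorphism of `b` has label `1`,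
i.e. lies in `Aut_ε(†𝒟^⊚)` (abc-iut-L5-t3's `AutEps`, Ex 4.3 (i)).
([IUTchI] Ex 5.4 (iv) p.149) [claim: Mochizuki2012, status: disputed] -/
theorem FPolyHomNF.labIsoG_baseGIso_eq_self_iff {X : S.FPrimeStrip} {Y : S.FAmbG} (δ : FPolyHomNF S X Y) (b : Y ≅ Y) :
    𝔡.labIsoG (S.baseGIso b) δ = δ ↔ autLabel (S.baseGIso b) = 1 :=
  labIsoG_eq_self_iff_autLabel_eq_one _ _

/-- The same with the subgroup `Aut_ε(†𝒟^⊚) ⊆ Aut(†𝒟^⊚)` by name. ([IUTchI] Ex 5.4 (iv) p.149)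
[claim: Mochizuki2012, status: disputed] -/
theorem FPolyHomNF.labIsoG_baseGIso_eq_self_iff_mem_autEps {X : S.FPrimeStrip} {Y : S.FAmbG} (δ : FPolyHomNF S X Y)
    (b : Y ≅ Y) : 𝔡.labIsoG (S.baseGIso b) δ = δ ↔ S.baseGIso b ∈ 𝔡.AutEps (S.baseG Y) :=
  (FPolyHomNF.labIsoG_baseGIso_eq_self_iff δ b).trans (mem_autEps_iff (S.baseGIso b)).symm

/-- Post-composition with `b`, base in `Aut_ε(†𝒟^⊚)`, FIXES every poly-morphism `‡ℱ → †ℱ^⊚`.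
([IUTchI] Ex 5.4 (iv) p.149) [claim: Mochizuki2012, status: disputed] -/
theorem FPolyHomNF.labIsoG_baseGIso_of_mem_autEps {X : S.FPrimeStrip} {Y : S.FAmbG} (δ : FPolyHomNF S X Y)
    {b : Y ≅ Y} (hb : S.baseGIso b ∈ 𝔡.AutEps (S.baseG Y)) : 𝔡.labIsoG (S.baseGIso b) δ = δ :=
  (FPolyHomNF.labIsoG_baseGIso_eq_self_iff_mem_autEps δ b).2 hb

/-- … hence also the induced `‡𝒟_v → †𝒟^⊚`: post-composing it with the base automorphism of such a `b` returns it.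
([IUTchI] Ex 5.4 (iv) p.149) [claim: Mochizuki2012, status: disputed] -/
theorem FPolyHomNF.under_post_of_mem_autEps {X : S.FPrimeStrip} {Y : S.FAmbG} (δ : FPolyHomNF S X Y) {b : Y ≅ Y}
    (hb : S.baseGIso b ∈ 𝔡.AutEps (S.baseG Y)) (v : 𝔡.V) :
    (FPolyHomNF.under δ v).post {S.baseGIso b} = FPolyHomNF.under δ v := by
  rw [← FPolyHomNF.under_labIsoG_baseGIso δ b v]
  exact congrArg (fun δ' : FPolyHomNF S X Y => FPolyHomNF.under δ' v) (FPolyHomNF.labIsoG_baseGIso_of_mem_autEps δ hb)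

/-- Conversely an automorphism of `†ℱ^⊚` whose base is NOT in `Aut_ε` MOVES every poly-morphism `‡ℱ → †ℱ^⊚` (it acts on
the torsor of choices by the non-trivial translation `autLabel⁻¹`). ([IUTchI] Ex 5.4 (iv) p.149)
[claim: Mochizuki2012, status: disputed] -/
theorem FPolyHomNF.labIsoG_baseGIso_ne_self {X : S.FPrimeStrip} {Y : S.FAmbG} (δ : FPolyHomNF S X Y) {b : Y ≅ Y}
    (hb : S.baseGIso b ∉ 𝔡.AutEps (S.baseG Y)) : 𝔡.labIsoG (S.baseGIso b) δ ≠ δ :=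
  fun h => hb ((FPolyHomNF.labIsoG_baseGIso_eq_self_iff_mem_autEps δ b).1 h)

/-! ### §4. «such a poly-morphism `‡ℱ → †ℱ^⊚` may be thought of as "lying over" an induced poly-morphism
`‡𝒟 → †𝒟^⊚`» (p. 148, last lines) -/

/-- The induced poly-morphism `‡𝒟_v → †𝒟^⊚` is INHABITED at every `v ∈ 𝕍`: starting from any `φ^NF`-type morphism,
post-compose with an automorphism of `†𝒟^⊚` of the right label (Ex 4.3 (i): every label is realised).
([IUTchI] Ex 5.4 (iv) p.148) [claim: Mochizuki2012, status: disputed] -/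
theorem FPolyHomNF.under_nonempty {X : S.FPrimeStrip} {Y : S.FAmbG} (δ : FPolyHomNF S X Y) (v : 𝔡.V) :
    (FPolyHomNF.under δ v).Nonempty := by
  obtain ⟨f₀⟩ : Nonempty (𝔡.HomNF v (X.base v) (S.baseG Y)) := by
    obtain ⟨κ⟩ := 𝔡.nonempty_iso v (X.base v) (𝔡.D v)
    obtain ⟨δ₀⟩ := 𝔡.nonempty_isoG 𝔡.DG (S.baseG Y)
    exact ⟨𝔡.postNF (𝔡.preNF κ (𝔡.phiNF v)) δ₀⟩
  obtain ⟨j, hj, -⟩ := (𝔡.isTorsor_labCusp v (X.base v)).existsUnique_smul_eq (𝔡.η v (X.base v)) (𝔡.labPull f₀ δ)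
  obtain ⟨d, hd⟩ := autLabelHom_surjective (S.baseG Y) j⁻¹
  refine ⟨𝔡.postNF f₀ d, ?_⟩
  show 𝔡.labPull (𝔡.postNF f₀ d) δ = 𝔡.η v (X.base v)
  have hd' : autLabel d = j⁻¹ := hd
  rw [𝔡.labPull_postNF, labIsoG_symm_eq_autLabel_smul, 𝔡.labPull_smul, ← hj, smul_smul, hd', inv_mul_cancel,
    one_smul]

/-- The members of the induced poly-morphism are `φ^NF`-type morphisms: each is abstractly equivalent (§0 p. 35) to the
natural `φ^NF_{•,v} : 𝒟_v → 𝒟^⊚` of Ex 4.3 (ii) («a poly-morphism `‡𝒟 → †𝒟^⊚` [cf. Definition 4.1, (vi)]»).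
([IUTchI] Ex 5.4 (iv) p.148) [claim: Mochizuki2012, status: disputed] -/
theorem FPolyHomNF.under_subset_setOf_exists_eq_phiNF {X : S.FPrimeStrip} {Y : S.FAmbG} (δ : FPolyHomNF S X Y)
    (v : 𝔡.V) : FPolyHomNF.under δ v ⊆
      {f | ∃ (a : X.base v ≅ 𝔡.D v) (b : 𝔡.DG ≅ S.baseG Y), f = 𝔡.postNF (𝔡.preNF a (𝔡.phiNF v)) b} :=
  fun f _ => 𝔡.exists_eq_phiNF f

/-- The induced `𝒟`-poly-morphisms of DISTINCT poly-morphisms `‡ℱ → †ℱ^⊚` are DISJOINT at every `v`: a common member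
would pull both classes back to `‡η_v`. ([IUTchI] Ex 5.4 (iv) p.148) [claim: Mochizuki2012, status: disputed] -/
theorem FPolyHomNF.eq_of_mem_under {X : S.FPrimeStrip} {Y : S.FAmbG} {δ δ' : FPolyHomNF S X Y} {v : 𝔡.V}
    {f : 𝔡.HomNF v (X.base v) (S.baseG Y)} (hf : f ∈ FPolyHomNF.under δ v) (hf' : f ∈ FPolyHomNF.under δ' v) :
    δ = δ' :=
  (𝔡.labPull f).injective (hf.trans hf'.symm)

/-- Hence the poly-morphism `‡ℱ → †ℱ^⊚` is DETERMINED by the induced `‡𝒟_v → †𝒟^⊚` at any single `v` («lying over»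
is faithful). ([IUTchI] Ex 5.4 (iv) p.148) [claim: Mochizuki2012, status: disputed] -/
theorem FPolyHomNF.under_injective (X : S.FPrimeStrip) (Y : S.FAmbG) (v : 𝔡.V) :
    Function.Injective fun δ : FPolyHomNF S X Y => FPolyHomNF.under δ v := by
  intro δ δ' h
  have h' : FPolyHomNF.under δ v = FPolyHomNF.under δ' v := h
  obtain ⟨f, hf⟩ := FPolyHomNF.under_nonempty δ v
  exact FPolyHomNF.eq_of_mem_under hf (h' ▸ hf)

/-! ### §5. Capsules: «a poly-morphism `{ᵉℱ}_{e∈E} → †ℱ^⊚` [is] a collection of poly-morphisms `{ᵉℱ → †ℱ^⊚}_{e∈E}`»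
(p. 149, last paragraph) -/

/-- Poly-morphisms of capsules `{ᵉℱ}_{e∈E} → †ℱ^⊚` exist. ([IUTchI] Ex 5.4 (iv) p.149) [claim: Mochizuki2012, status: disputed] -/
theorem FCapsule.PolyHomNF.nonempty {E : Type} (X : S.FCapsule E) (Y : S.FAmbG) :
    Nonempty (FCapsule.PolyHomNF X Y) :=
  ⟨fun e => (FPolyHomNF.nonempty (X e) Y).some⟩

/-- There are exactly `(l^⋇)^{|E|}` poly-morphisms `{ᵉℱ}_{e∈E} → †ℱ^⊚` for a finite index set `E` (one `δ_e` per
constituent). ([IUTchI] Ex 5.4 (iv) p.149) [claim: Mochizuki2012, status: disputed] -/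
theorem FCapsule.PolyHomNF.card_eq {E : Type} [Finite E] (X : S.FCapsule E) (Y : S.FAmbG) :
    Nat.card (FCapsule.PolyHomNF X Y) = lStar 𝔡.l ^ Nat.card E := by
  haveI := Fintype.ofFinite E
  unfold FCapsule.PolyHomNF
  rw [Nat.card_pi, Finset.prod_congr rfl fun e _ => FPolyHomNF.card_eq (X e) Y, Finset.prod_const,
    Finset.card_univ, ← Nat.card_eq_fintype_card]

/-- «a poly-morphism `{ᵉℱ}_{e∈E} → †ℱ^⊚` may be thought of as "lying over" an induced poly-morphism
`{ᵉ𝒟}_{e∈E} → †𝒟^⊚`»: constituent by constituent the induced `𝒟`-poly-morphisms are inhabited.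
([IUTchI] Ex 5.4 (iv) p.149) [claim: Mochizuki2012, status: disputed] -/
theorem FCapsule.PolyHomNF.under_nonempty {E : Type} {X : S.FCapsule E} {Y : S.FAmbG} (ψ : FCapsule.PolyHomNF X Y)
    (e : E) (v : 𝔡.V) : (FPolyHomNF.under (ψ e) v).Nonempty :=
  FPolyHomNF.under_nonempty (ψ e) v

end S5Local

end BaseThetaDatum

/-! ### §6. NON-VACUITY at the §5-R4 stub of record over abc-iut-L5-t2's REAL initial Θ-data (parametric bad-pair
datum; abc-iut-w4-d054 `s5LocalThetaOfBadPairs`, p497623) «[KIT-RULE stub `ℱ := 𝒟`, Θ-NF kit, bad-pair DATA `B` — labelled]» -/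

section OfBadPairs

variable {F : Type u} {K : Type*} {Fbar : Type*} [Field F] [NumberField F] [Field K] [NumberField K]
  [Algebra F K] [Field Fbar] [Algebra F Fbar] [Algebra K Fbar]
  {E : WeierstrassCurve F} [E.IsElliptic] {l : ℕ} {Pb : BadPlacePredicates K}
  (D : InitialThetaData F K Fbar E l Pb) (CG : D.geom.pe.CuspGalois) (hS : D.CuspClassesNormaliserStable) [Fact l.Prime]
  (M : D.TorsionMonodromy) (hA : D.geom.pe.ArrowCoveringClaims)
  (hI : ∀ k ∈ D.geom.pe.inertia D.geom.pe.ε1, M.tau (D.geom.embK k) = 0)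
  (B : ∀ v, v ∈ D.indexCopyBad → D.BadPairAt v) (ΛBad : ∀ v (h : v ∈ D.indexCopyBad), D.LocalArrowLaw CG hS (B v h).H)

namespace InitialThetaData

variable {Gv : D.IndexCopy → Subgroup (Fbar ≃ₐ[F] Fbar)}
  (ES : ∀ v, v ∈ D.indexCopyBad → EvalSectionBinder (D.localDataOfBadPairs CG hS M hA hI B ΛBad v) (Gv v))

/-- **JOINT NON-VACUITY of the Ex 5.4 (iv) binders at the stub of record** `S := D.s5LocalThetaOfBadPairs … ES`: an
`ℱ`-prime-strip `‡ℱ`, an isomorph `†ℱ^⊚`, a poly-morphism `δ : ‡ℱ → †ℱ^⊚` and an automorphism `b` of `†ℱ^⊚` with base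
in `Aut_ε` EXIST together, `b` fixes `δ`, the induced `‡𝒟_v → †𝒟^⊚` is inhabited at every `v`, pre-composition with
every automorphism of `‡ℱ` fixes it, and its full poly-isomorphism is inhabited.  Honest label: KIT-RULE stub (see §6
header). ([IUTchI] Ex 5.4 (iv) p.148) [claim: Mochizuki2012, status: disputed] -/
theorem exists_fPolyHomNF_s5LocalThetaOfBadPairs :
    ∃ (X : (D.s5LocalThetaOfBadPairs CG hS M hA hI B ΛBad ES).FPrimeStrip)
      (Y : (D.s5LocalThetaOfBadPairs CG hS M hA hI B ΛBad ES).FAmbG)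
      (δ : BaseThetaDatum.S5Local.FPolyHomNF (D.s5LocalThetaOfBadPairs CG hS M hA hI B ΛBad ES) X Y) (b : Y ≅ Y),
      (D.s5LocalThetaOfBadPairs CG hS M hA hI B ΛBad ES).baseGIso b ∈
          (D.baseThetaDatumThetaOfBadPairs CG hS M hA hI B ΛBad ES).AutEps _ ∧
        (D.baseThetaDatumThetaOfBadPairs CG hS M hA hI B ΛBad ES).labIsoG
            ((D.s5LocalThetaOfBadPairs CG hS M hA hI B ΛBad ES).baseGIso b) δ = δ ∧
        (∀ v, (BaseThetaDatum.S5Local.FPolyHomNF.under δ v).Nonempty) ∧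
        (∀ (a : X ≅ X) v, (BaseThetaDatum.S5Local.FPolyHomNF.under δ v).pre
            (((D.s5LocalThetaOfBadPairs CG hS M hA hI B ΛBad ES).base v).mapIso (Pi.isoApp a v)) =
          BaseThetaDatum.S5Local.FPolyHomNF.under δ v) ∧
        (δ.polyIso : Set _).Nonempty := by
  set S := D.s5LocalThetaOfBadPairs CG hS M hA hI B ΛBad ES
  obtain ⟨δ⟩ := BaseThetaDatum.S5Local.FPolyHomNF.nonempty (S := S) S.F S.FG
  have hb : S.baseGIso (Iso.refl S.FG) ∈ (D.baseThetaDatumThetaOfBadPairs CG hS M hA hI B ΛBad ES).AutEps _ :=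
    (BaseThetaDatum.mem_autEps_iff _).2 (by rw [S.baseGIso_refl]; exact BaseThetaDatum.autLabel_refl _)
  exact ⟨S.F, S.FG, δ, Iso.refl _, hb, BaseThetaDatum.S5Local.FPolyHomNF.labIsoG_baseGIso_of_mem_autEps δ hb,
    BaseThetaDatum.S5Local.FPolyHomNF.under_nonempty δ,
    fun a v => BaseThetaDatum.S5Local.FPolyHomNF.under_pre_fAut δ a v,
    BaseThetaDatum.S5Local.FPolyHomNF.polyIso_nonempty δ⟩

/-- At the stub of record there are exactly `l^⋇` poly-morphisms `‡ℱ → †ℱ^⊚` between any `‡ℱ` and any `†ℱ^⊚`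
(`l` = the prime of the REAL initial Θ-datum `D`). ([IUTchI] Ex 5.4 (iv) p.148) [claim: Mochizuki2012, status: disputed] -/
theorem card_fPolyHomNF_s5LocalThetaOfBadPairs (X : (D.s5LocalThetaOfBadPairs CG hS M hA hI B ΛBad ES).FPrimeStrip)
    (Y : (D.s5LocalThetaOfBadPairs CG hS M hA hI B ΛBad ES).FAmbG) :
    Nat.card (BaseThetaDatum.S5Local.FPolyHomNF (D.s5LocalThetaOfBadPairs CG hS M hA hI B ΛBad ES) X Y) = lStar l :=
  BaseThetaDatum.S5Local.FPolyHomNF.card_eq X Y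

end InitialThetaData

end OfBadPairs

end Literature.IUT.HodgeTheaters
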